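import Literature.MathematicalPhysics.QuantumFieldTheory.Balaban1983to89.B9Eq319QprimeLipschitz

/-!
# `Balaban1983to89.B9Eq319CentreLiftL2` — T. Bałaban, *Propagators for lattice gauge theories in a background field*, Commun. Math. Phys.
# **99** (1985) 389–434 [Balaban1985BackgroundPropagators] (3.19) p. 393, (3.11) p. 392, (3.81)/(3.83) pp. 406–407: THE CENTRE RIGHT INVERSE `S₀` OF
# THE ONE-STEP AVERAGING `Q′` IN HILBERT CURRENCY, AND THE `Q′`-REMAINDER `S₀(Q′(U) − Q′(1))` OF THE pub-balaban NE9 CHAIN WITH A VOLUME-FREE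
# CONSTANT — `‖S₀(Q′(U)λ − Q′(1)λ)‖_{L²} ≤ √(L^d)·((1 + ε)^{d(L−1)} − 1)·‖λ‖_{L²}`

statement-level skeleton of published theorems with citation tags; proofs where landed; nothing here is a claim about the Yang–Mills mass gap

PDF held: `paper:balaban1985-cmp99-background-propagators` (journal page = PDF page + 388), pp. 392–393, 403, 406–407 read by this seat (2026-08-22)
in the held text layer.

THE PRINT (verbatim).  p. 393, (3.19): *«(Q′(V)λ)(y) = Σ_{x∈B(y)} L^{−d} R(V(Γ_{y,x}))λ(x)»*.  p. 406, after (3.81): *«for Mα₀, α₁ sufficiently small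
and with a constant O(1) depending on d and L only. We have a similar expansion for Q′_j(U′U), i.e. Q′_j(U′U) = Q′_j(U) + F′_{2,j}(A), and F′_{2,j}(A)
satisfies (3.81).»*  p. 407, after (3.82): *«The operator P₂(A) is a sum of three terms obtained by the expansion of averaging operators. It is a
semi-local operator in the sense that the value (P₂(A)A′)(b) at a bond b ∈ B_j(Λ_j) depends on A, A′ restricted to j-blocks neighbouring the block
containing the bond b.»*  p. 392, (3.11): the weighted `L²` scalar product of gauge parameters.

WHY THIS FILE (cell context).  The NE9 owner's (gen 80) fixed-lattice second half of [B9] Thm 3.11, `B9Thm311SmallFieldCoercivity.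
norm_principalGF_sub_flat_le` (§5, staged 2026-08-22), displays the `R(U)`-remainder input as the slot
`hρ : ∀ l, ‖S₀(Q′(U)l − Q′(1)l)‖ ≤ ρ‖l‖`, where `S₀ω := (WL2.equiv ℂ (fun _ ↦ c₀) W).symm (centreFun (weight L m) (centre L m) ω)` is the CENTRE
LIFT — the right inverse of `Q′(V)` for every `V` (`B9Eq384RemainderLetters.QprimeW_centre`; `B9Eq319QprimeTorus.Qprime_centreFun`).  Its §6 fills the
slot through the SUP currency of the averaging letter (`‖Q′(U)l − Q′(1)l‖_∞ ≤ ρ′‖l‖`, `B9Eq319QprimeLipschitz.norm_QprimeW_sub_flat_le_L2`, this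
lineage gen 57) and the sup → `L²` bound `B9Eq384RemainderLetters.norm_centre_le` with constant `L^d·√(c₀·#sites)` — a VOLUME factor.  Print's remainders
(3.81)/(3.83) are semi-local with constants «depending on d and L only».  This file discharges the slot `hρ` IN ITS OWN SHAPE with the volume-free
constant `ρ = √(L^d)·ρ′`, `ρ′ = (1 + ε)^{d(L−1)} − 1`, from the HILBERT currency of the same letter (`B9Eq319QprimeLipschitz.sum_norm_sq_QprimeW_sub_flat_le`:
`Σ_y ‖(Q′(U)λ − Q′(1)λ)(y)‖² ≤ ρ′²·(L^d·c₀)⁻¹·‖λ‖²`) and the exact `L²` norm of the centre lift.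

WHAT IS PROVED (sorry-free; no `Prop` placeholder; no inequality of the paper asserted).
* §1 `norm_centreFun_centre` (`‖(S₀ω)(centre y)‖ = L^d·‖ω(y)‖`), **`norm_sq_centreLift_eq`**: `‖S₀ω‖²_{L²} = c₀·(L^d)²·Σ_y ‖ω(y)‖²` (the lift is supported
  on the centres, one per block); `norm_centreLift_le_of_sum_sq_le` (`Σ_y‖ω(y)‖² ≤ B²`, `0 ≤ B` ⇒ `‖S₀ω‖ ≤ √c₀·L^d·B`).
* §2 **`norm_centreLift_QprimeW_sub_flat_le`**: for `ℂ`-linear transporters `R(U(b))` read on the Hilbert fibre with `‖R(U(b))w − w‖ ≤ ε‖w‖`,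
  `‖S₀(Q′(U)λ − Q′(1)λ)‖ ≤ √(L^d)·((1 + ε)^{d(L−1)} − 1)·‖λ‖` for every `λ` of the `L²` carrier `SiteL2K ℂ d (L·m) c₀ W` — the slot `hρ` of
  `B9Thm311SmallFieldCoercivity.norm_principalGF_sub_flat_le` verbatim, with NO dependence on the volume `m` or on `c₀`;
  `norm_centreLift_QprimeW_sub_flat_le_linear`: for `ε ≤ 1` the linear form `≤ √(L^d)·d(L−1)·2^{d(L−1)}·ε·‖λ‖` (`B9Eq319QprimeLipschitz.rho_le`).
MODEL / DECLARED READINGS.  (M1) one averaging step on the periodic lattice `TSite d (L·m)`, blocks of side `L`, the weighted `L²` space (3.11) with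
constant weight `c₀ > 0`, `W`-valued gauge parameters; the transporters enter only through the displayed closeness `ε` (its derivation from a small field
is `B9Eq384RemainderLetters.norm_adTransportW_sub_le`, owner).  (M2) no hypothesis of the paper is displayed.  (M3) the constant is explicit and independent
of the volume and of `c₀`, but depends on `L`, `d`; NOT print's (3.81) (which is the multi-level statement with `O(1)α₁` through [Balaban1985Averaging]
(143)) and no uniformity of [B9] Thm 3.11 is claimed.
HONEST SCOPE.  [folklore] finite-lattice bookkeeping (a sum over the centres + one landed inequality); one displayed slot of the owner's fixed-lattice
Thm 3.11 second half becomes volume-free; NOT Thm 3.11, NOT (L3) W, NOT summit progress (cell pub-balaban: NE9 NOT PRINTED / NOT PROVED; «NE9 ⇐ the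
named binders»; spine PROVED 0/9; HONEST DEPENDENCY: continuum YM on T⁴ ⇐ BetaPertH ∧ nine spine estimates (0/9 proved); BetaPertH ⇐ (D1) ∧ (D4) ∧
CAP+tail; G-an2-4 gates asym, D1 and NE2/3/4).  Unit `b2b-balaban-t4-ne9-formalise-leaf-03` (NE9 crux-team leaf prover, gen 58); NEW file importing
`B9Eq319QprimeLipschitz` only; modifies nothing.  Net new unproved facts: 0.
-/

noncomputable section

open scoped BigOperators

namespace Literature.MathematicalPhysics.QuantumFieldTheory.Balaban1983to89.B9Eq319CentreLiftL2

open B4Sect5Torus (TSite)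
open B9SectCLatticeCarrier (Bond)
open B9Eq319Onto (centreFun centreFun_centre centreFun_off_centre)
open B9Eq319QprimeTorus (fineP centre weight centre_injective)
open B9Eq310HessianOperator (adTransportW)
open B9Eq326OperatorAssembly (QprimeW)
open B9Eq311L2Pairing (WL2)
open B11Eq103H1Complex (SiteL2K)
open B9Eq319QprimeLipschitz (sum_norm_sq_QprimeW_sub_flat_le rho_nonneg rho_le)

variable {d : ℕ} (L : ℕ) [NeZero L] (m : Fin d → ℕ)

/-! ## §1 The centre lift `S₀` in Hilbert currency: `‖S₀ω‖² = c₀·L^{2d}·Σ_y ‖ω(y)‖²` -/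

section Lift

variable {W : Type*} [NormedAddCommGroup W] [InnerProductSpace ℂ W] {c₀ : ℝ}

/-- The centre lift at a centre: `(S₀ω)(L·y) = L^d·ω(y)`, so `‖(S₀ω)(L·y)‖ = L^d·‖ω(y)‖`. [folklore] [cite: Balaban1985BackgroundPropagators, (3.19) p.393] -/
theorem norm_centreFun_centre (ω : TSite d m → W) (y : TSite d m) :
    ‖centreFun (weight L m) (centre L m) ω (centre L m y)‖ = (L : ℝ) ^ d * ‖ω y‖ := by
  rw [centreFun_centre _ _ (centre_injective L m), norm_smul, weight, inv_inv, norm_pow, Real.norm_natCast]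

variable [Fact (0 < c₀)]

/-- **THE `L²` NORM (3.11) OF THE CENTRE LIFT, EXACTLY**: `‖S₀ω‖² = c₀·(L^d)²·Σ_y ‖ω(y)‖²` — the lift vanishes off the centres and the centre map
`y ↦ L·y` is injective, so the weighted sum over the fine sites collapses to the sum over the blocks. [folklore]
[cite: Balaban1985BackgroundPropagators, (3.19) p.393, (3.11) p.392] -/
theorem norm_sq_centreLift_eq (ω : TSite d m → W) :
    ‖(WL2.equiv ℂ (fun _ : TSite d (fineP L m) => c₀) W).symm (centreFun (weight L m) (centre L m) ω)‖ ^ 2 =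
      c₀ * ((L : ℝ) ^ d) ^ 2 * ∑ y, ‖ω y‖ ^ 2 := by
  rw [WL2.norm_sq]
  simp only [Equiv.apply_symm_apply]
  have hvan : ∀ x ∈ (Finset.univ : Finset (TSite d (fineP L m))), x ∉ Finset.univ.image (centre L m) →
      c₀ * ‖centreFun (weight L m) (centre L m) ω x‖ ^ 2 = 0 := fun x _ hx => by
    rw [centreFun_off_centre _ _ ω x fun c h => hx (Finset.mem_image.2 ⟨c, Finset.mem_univ _, h⟩), norm_zero]
    ring
  rw [← Finset.sum_subset (Finset.subset_univ (Finset.univ.image (centre L m))) hvan,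
    Finset.sum_image fun y _ y' _ h => centre_injective L m h, Finset.mul_sum]
  exact Finset.sum_congr rfl fun y _ => by rw [norm_centreFun_centre]; ring

/-- The centre lift is bounded from the coarse `ℓ²` norm into `L²` with constant `√c₀·L^d`: `Σ_y‖ω(y)‖² ≤ B²` ⇒ `‖S₀ω‖ ≤ √c₀·L^d·B`. [folklore]
[cite: Balaban1985BackgroundPropagators, (3.19) p.393, (3.11) p.392] -/
theorem norm_centreLift_le_of_sum_sq_le (ω : TSite d m → W) {B : ℝ} (hB0 : 0 ≤ B) (hB : ∑ y, ‖ω y‖ ^ 2 ≤ B ^ 2) :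
    ‖(WL2.equiv ℂ (fun _ : TSite d (fineP L m) => c₀) W).symm (centreFun (weight L m) (centre L m) ω)‖ ≤
      Real.sqrt c₀ * (L : ℝ) ^ d * B := by
  have hc : 0 < c₀ := Fact.out
  refine (pow_le_pow_iff_left₀ (norm_nonneg _) (by positivity) two_ne_zero).1 ?_
  rw [norm_sq_centreLift_eq, mul_pow, mul_pow, Real.sq_sqrt hc.le]
  exact mul_le_mul_of_nonneg_left hB (by positivity)

end Lift

/-! ## §2 The `Q′`-remainder through the centre lift, volume-free: `‖S₀(Q′(U)λ − Q′(1)λ)‖ ≤ √(L^d)·ρ′·‖λ‖` -/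

section Remainder

variable {𝔸 : Type*} [Ring 𝔸] [Algebra ℂ 𝔸] {W : Type*} [NormedAddCommGroup W] [InnerProductSpace ℂ W] (φ : W ≃ₗ[ℂ] 𝔸) {c₀ : ℝ}
  [Fact (0 < c₀)] (U : Bond d (fineP L m) → 𝔸ˣ)

/-- **THE `Q′`-REMAINDER OF THE NE9 CHAIN THROUGH THE CENTRE LIFT, WITH A VOLUME-FREE CONSTANT**: for transporters `R(U(b))` (read on the Hilbert
fibre) with `‖R(U(b))w − w‖ ≤ ε‖w‖`, `‖S₀(Q′(U)λ − Q′(1)λ)‖_{L²} ≤ √(L^d)·((1 + ε)^{d(L−1)} − 1)·‖λ‖_{L²}` — the slot `hρ` of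
`B9Thm311SmallFieldCoercivity.norm_principalGF_sub_flat_le` in its own shape: `c₀·(L^d)²` from §1 against `ρ′²·(L^d·c₀)⁻¹` from the Hilbert currency of
the averaging letter. [cite: Balaban1985BackgroundPropagators, (3.19) p.393, p.403, (3.81) p.406, (3.83) p.407] -/
theorem norm_centreLift_QprimeW_sub_flat_le {ε : ℝ} (hε : 0 ≤ ε) (hR : ∀ b w, ‖adTransportW φ U b w - w‖ ≤ ε * ‖w‖)
    (lam : SiteL2K ℂ d (fineP L m) c₀ W) :
    ‖(WL2.equiv ℂ (fun _ : TSite d (fineP L m) => c₀) W).symm (centreFun (weight L m) (centre L m)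
        (QprimeW L m φ U (c₀ := c₀) lam - QprimeW L m φ (fun _ : Bond d (fineP L m) => (1 : 𝔸ˣ)) (c₀ := c₀) lam))‖ ≤
      Real.sqrt ((L : ℝ) ^ d) * ((1 + ε) ^ (d * (L - 1)) - 1) * ‖lam‖ := by
  have hc : 0 < c₀ := Fact.out
  have hL0 : (0 : ℝ) < (L : ℝ) ^ d := pow_pos (Nat.cast_pos.2 (Nat.pos_of_ne_zero (NeZero.ne L))) d
  have hρ : 0 ≤ (1 + ε) ^ (d * (L - 1)) - 1 := rho_nonneg L (d := d) hε
  have hsum := sum_norm_sq_QprimeW_sub_flat_le L m φ U (c₀ := c₀) hε hR lam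
  refine (pow_le_pow_iff_left₀ (norm_nonneg _) (mul_nonneg (mul_nonneg (Real.sqrt_nonneg _) hρ) (norm_nonneg _)) two_ne_zero).1 ?_
  rw [norm_sq_centreLift_eq]
  simp only [Pi.sub_apply]
  calc c₀ * ((L : ℝ) ^ d) ^ 2 * ∑ y, ‖QprimeW L m φ U (c₀ := c₀) lam y - QprimeW L m φ (fun _ : Bond d (fineP L m) => (1 : 𝔸ˣ)) (c₀ := c₀) lam y‖ ^ 2
      ≤ c₀ * ((L : ℝ) ^ d) ^ 2 * (((1 + ε) ^ (d * (L - 1)) - 1) ^ 2 * (((L : ℝ) ^ d * c₀)⁻¹ * ‖lam‖ ^ 2)) :=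
        mul_le_mul_of_nonneg_left hsum (by positivity)
    _ = (Real.sqrt ((L : ℝ) ^ d) * ((1 + ε) ^ (d * (L - 1)) - 1) * ‖lam‖) ^ 2 := by
        rw [mul_pow, mul_pow, Real.sq_sqrt hL0.le]
        field_simp

/-- **THE SAME, LINEAR IN `ε ≤ 1`**: `‖S₀(Q′(U)λ − Q′(1)λ)‖ ≤ √(L^d)·d(L−1)·2^{d(L−1)}·ε·‖λ‖` (`(1+ε)^n − 1 ≤ nε(1+ε)^n ≤ nε2^n`). The constant depends on
`d` and `L` only (print, p. 406: «a constant O(1) depending on d and L only»). [cite: Balaban1985BackgroundPropagators, (3.81) p.406, (3.83) p.407] -/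
theorem norm_centreLift_QprimeW_sub_flat_le_linear {ε : ℝ} (hε : 0 ≤ ε) (hε1 : ε ≤ 1) (hR : ∀ b w, ‖adTransportW φ U b w - w‖ ≤ ε * ‖w‖)
    (lam : SiteL2K ℂ d (fineP L m) c₀ W) :
    ‖(WL2.equiv ℂ (fun _ : TSite d (fineP L m) => c₀) W).symm (centreFun (weight L m) (centre L m)
        (QprimeW L m φ U (c₀ := c₀) lam - QprimeW L m φ (fun _ : Bond d (fineP L m) => (1 : 𝔸ˣ)) (c₀ := c₀) lam))‖ ≤
      Real.sqrt ((L : ℝ) ^ d) * ((d * (L - 1) : ℕ) * 2 ^ (d * (L - 1))) * ε * ‖lam‖ := by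
  refine (norm_centreLift_QprimeW_sub_flat_le L m φ U hε hR lam).trans ?_
  have h1 : (1 + ε) ^ (d * (L - 1)) - 1 ≤ (d * (L - 1) : ℕ) * ε * (1 + ε) ^ (d * (L - 1)) := rho_le L (d := d) hε
  have h2 : (1 + ε) ^ (d * (L - 1)) ≤ 2 ^ (d * (L - 1)) := pow_le_pow_left₀ (by positivity) (by linarith) _
  have h3 : (1 + ε) ^ (d * (L - 1)) - 1 ≤ (d * (L - 1) : ℕ) * 2 ^ (d * (L - 1)) * ε :=
    h1.trans (by
      calc (d * (L - 1) : ℕ) * ε * (1 + ε) ^ (d * (L - 1)) ≤ (d * (L - 1) : ℕ) * ε * 2 ^ (d * (L - 1)) :=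
            mul_le_mul_of_nonneg_left h2 (by positivity)
        _ = (d * (L - 1) : ℕ) * 2 ^ (d * (L - 1)) * ε := by ring)
  calc Real.sqrt ((L : ℝ) ^ d) * ((1 + ε) ^ (d * (L - 1)) - 1) * ‖lam‖
      ≤ Real.sqrt ((L : ℝ) ^ d) * ((d * (L - 1) : ℕ) * 2 ^ (d * (L - 1)) * ε) * ‖lam‖ := by gcongr
    _ = Real.sqrt ((L : ℝ) ^ d) * ((d * (L - 1) : ℕ) * 2 ^ (d * (L - 1))) * ε * ‖lam‖ := by ring

end Remainder

end Literature.MathematicalPhysics.QuantumFieldTheory.Balaban1983to89.B9Eq319CentreLiftL2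

end
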